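import Mathlib
import Summits.Ventures.PercRepro2.Defs
import Summits.Ventures.PercRepro2.Harris
import Summits.Ventures.PercRepro2.Independence
import Summits.Ventures.PercRepro2.CoinDefs
import Summits.Ventures.PercRepro2.CoinReverse
import Summits.Ventures.PercRepro2.CoinStarDefs
import Summits.Ventures.PercRepro2.CoinLsmCoreDefs
import Summits.Ventures.PercRepro2.CoinLsmCoreU
import Summits.Ventures.PercRepro2.CoinCoreGate
import Summits.Ventures.PercRepro2.CoinOrTailAlg
import Summits.Ventures.PercRepro2.CoinOrTailDefs
import Summits.Ventures.PercRepro2.CoinOrTailLsmDefs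
import Summits.Ventures.PercRepro2.CoinOrTailLsmSums
import Summits.Ventures.PercRepro2.CoinOrTailBlockAlg
import Summits.Ventures.PercRepro2.CoinOrTailBlockSums
import Summits.Ventures.PercRepro2.CoinOrTailMixLsm
import Summits.Ventures.PercRepro2.CoinLsmCoreSure
import Summits.Ventures.PercRepro2.CoinOrTailKDefs
import Summits.Ventures.PercRepro2.CoinOrTailKSums
import Summits.Ventures.PercRepro2.CoinOrTailKAlg
import Summits.Ventures.PercRepro2.CoinOrTailCovCore
import Summits.Ventures.PercRepro2.CoinOrTailKCore
import Summits.Ventures.PercRepro2.CoinK2HeadBlindVals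
import Summits.Ventures.PercRepro2.CoinK2HeadBlindSums
import Summits.Ventures.PercRepro2.CoinK2StateLayer
import Summits.Ventures.PercRepro2.CoinK2StateCells
import Summits.Ventures.PercRepro2.CoinK2HeadAwareAD
import Summits.Ventures.PercRepro2.CoinK2HeadAwareCells

/-!
# Row 2′DARC at an OR-tail with TWO INCOMPARABLE UNCOVERED entries — the HEAD-AWARE functional
(blind cell PercRepro2, night-2 g13; proofs/NIGHT2-DARC.md §48)

`orTailK2_functional_nonneg`: `ent = {r₁, r₂}` with sure coins, `ν` log-supermodular, the head `A`
nonnegative, decreasing, log-supermodular — NOTHING else (no head-blindness, no non-degeneracy):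
the 28 state × block cells of `ν · rValK` and `ν · gValK` satisfy the hypotheses of the block
theorem `k2State_nonneg` (the `cell*` lemmas of `CoinK2HeadAwareCells`, fed by `rValK_mul_le_all`,
`gValK_mul_le_all` and `rValK_mul_gValK_le_of_entry`); `darc_of_orTailK2` is row 2′DARC. -/

namespace Summit.Ventures.PercRepro2.Coin

open Classical

section K2AwareFunctional

variable {V : Type*} {E : Type*} [Fintype V] [DecidableEq V] {R : Type*} [Field R] [LinearOrder R]
  [IsStrictOrderedRing R]

omit [Fintype V] [LinearOrder R] [IsStrictOrderedRing R] in
/-- `mWt m true` is the marker indicator. -/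
lemma mWt_true_apply (m : V) (W : Finset V) :
    mWt (R := R) m true W = if m ∈ W then 1 else 0 := by
  unfold mWt; simp

omit [Fintype V] [LinearOrder R] [IsStrictOrderedRing R] in
/-- A marker sum splits into its four entry states. -/
lemma marker_state_split (U : Finset V) (F : Finset V → R) (r₁ r₂ : V) (J : Finset V → R) :
    (∑ W ∈ U.powerset, F W * J W) =
      (∑ W ∈ U.powerset, F W * (cellWt r₁ r₂ false false W * J W)) +
      (∑ W ∈ U.powerset, F W * (cellWt r₁ r₂ false true W * J W)) +
      (∑ W ∈ U.powerset, F W * (cellWt r₁ r₂ true false W * J W)) +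
      (∑ W ∈ U.powerset, F W * (cellWt r₁ r₂ true true W * J W)) := by
  rw [sum_split_four U (fun W => F W * J W) r₁ r₂]
  congr 1 <;> [congr 1; skip] <;> [congr 1; skip; skip] <;>
    exact Finset.sum_congr rfl fun W _ => by ring

omit [Fintype V] [LinearOrder R] [IsStrictOrderedRing R] in
/-- The indicator of `[r₁]` is the sum of two state indicators. -/
lemma sum_filter_r₁ (U : Finset V) (F : Finset V → R) (r₁ r₂ : V) (J : Finset V → R) :
    (∑ W ∈ U.powerset, F W * (mWt r₁ true W * J W)) =
      (∑ W ∈ U.powerset, F W * (cellWt r₁ r₂ true false W * J W)) +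
      (∑ W ∈ U.powerset, F W * (cellWt r₁ r₂ true true W * J W)) := by
  rw [← Finset.sum_add_distrib]
  exact Finset.sum_congr rfl fun W _ => by rw [mWt_true_eq_cell_sum r₁ r₂ W]; ring

omit [Fintype V] [LinearOrder R] [IsStrictOrderedRing R] in
/-- The indicator of `[r₂]` is the sum of two state indicators. -/
lemma sum_filter_r₂ (U : Finset V) (F : Finset V → R) (r₁ r₂ : V) (J : Finset V → R) :
    (∑ W ∈ U.powerset, F W * (mWt r₂ true W * J W)) =
      (∑ W ∈ U.powerset, F W * (cellWt r₁ r₂ false true W * J W)) +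
      (∑ W ∈ U.powerset, F W * (cellWt r₁ r₂ true true W * J W)) := by
  rw [← Finset.sum_add_distrib]
  exact Finset.sum_congr rfl fun W _ => by rw [mWt_true_eq_cell_sum' r₁ r₂ W]; ring

omit [Fintype V] [DecidableEq V] [LinearOrder R] [IsStrictOrderedRing R] in
/-- A plain sum is the sum with the unit marker factor. -/
lemma sum_mul_one (U : Finset V) (F : Finset V → R) :
    (∑ W ∈ U.powerset, F W) = ∑ W ∈ U.powerset, F W * 1 :=
  Finset.sum_congr rfl fun W _ => by ring

omit [Fintype V] [LinearOrder R] [IsStrictOrderedRing R] in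
/-- The `[r₁]`-filtered plain sum in state cells. -/
lemma sum_filter_r₁_one (U : Finset V) (F : Finset V → R) (r₁ r₂ : V) :
    (∑ W ∈ U.powerset, F W * mWt r₁ true W) =
      (∑ W ∈ U.powerset, F W * (cellWt r₁ r₂ true false W * 1)) +
      (∑ W ∈ U.powerset, F W * (cellWt r₁ r₂ true true W * 1)) := by
  have := sum_filter_r₁ U F r₁ r₂ (fun _ => 1)
  simp only [mul_one] at this ⊢
  exact this

omit [Fintype V] [LinearOrder R] [IsStrictOrderedRing R] in
/-- The `[r₂]`-filtered plain sum in state cells. -/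
lemma sum_filter_r₂_one (U : Finset V) (F : Finset V → R) (r₁ r₂ : V) :
    (∑ W ∈ U.powerset, F W * mWt r₂ true W) =
      (∑ W ∈ U.powerset, F W * (cellWt r₁ r₂ false true W * 1)) +
      (∑ W ∈ U.powerset, F W * (cellWt r₁ r₂ true true W * 1)) := by
  have := sum_filter_r₂ U F r₁ r₂ (fun _ => 1)
  simp only [mul_one] at this ⊢
  exact this

/-- **THE HEAD-AWARE TWO-ENTRY OR-TAIL FUNCTIONAL IS NONNEGATIVE**: `ent = {r₁, r₂}` with sure
coins, the cluster law `ν` log-supermodular, the head `A` nonnegative, decreasing and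
log-supermodular; ANY two markers; no further hypothesis. -/
theorem orTailK2_functional_nonneg (U : Finset V) (ν A : Finset V → R) (pr : E → R)
    (ent : Finset V) (c : V → E) (r₁ r₂ m₁ m₂ a w : V)
    (hp0 : ∀ e, 0 ≤ pr e) (hp1 : ∀ e, pr e ≤ 1) (hsure : ∀ r ∈ ent, pr (c r) = 1)
    (hr₁ : r₁ ∈ ent) (hr₂ : r₂ ∈ ent) (hent : ∀ r ∈ ent, r = r₁ ∨ r = r₂)
    (hν0 : ∀ W, 0 ≤ ν W) (hν : ∀ s ⊆ U, ∀ t ⊆ U, ν s * ν t ≤ ν (s ∩ t) * ν (s ∪ t))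
    (hA0 : ∀ W, 0 ≤ A W) (hA : ∀ s t : Finset V, A s * A t ≤ A (s ∩ t) * A (s ∪ t))
    (hmono : ∀ s t : Finset V, s ⊆ t → A t ≤ A s) :
    0 ≤ (∑ W ∈ U.powerset, ν W * rValK A pr ent c a W) ^ 2 *
          (∑ W ∈ U.powerset, ν W * gValK A pr ent c a w W *
            ((if m₁ ∈ W then (1 : R) else 0) * (if m₂ ∈ W then (1 : R) else 0)))
        - (∑ W ∈ U.powerset, ν W * rValK A pr ent c a W) *
          (∑ W ∈ U.powerset, ν W * rValK A pr ent c a W * (if m₁ ∈ W then (1 : R) else 0)) *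
          (∑ W ∈ U.powerset, ν W * gValK A pr ent c a w W * (if m₂ ∈ W then (1 : R) else 0))
        - (∑ W ∈ U.powerset, ν W * rValK A pr ent c a W) *
          (∑ W ∈ U.powerset, ν W * rValK A pr ent c a W * (if m₂ ∈ W then (1 : R) else 0)) *
          (∑ W ∈ U.powerset, ν W * gValK A pr ent c a w W * (if m₁ ∈ W then (1 : R) else 0))
        + (∑ W ∈ U.powerset, ν W * rValK A pr ent c a W * (if m₁ ∈ W then (1 : R) else 0)) *
          (∑ W ∈ U.powerset, ν W * rValK A pr ent c a W * (if m₂ ∈ W then (1 : R) else 0)) *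
          (∑ W ∈ U.powerset, ν W * gValK A pr ent c a w W) := by
  have hr0 : ∀ W, 0 ≤ rValK A pr ent c a W := fun W => rValK_nonneg hp0 hp1 hA0 ent c a W
  have hg0 : ∀ W, 0 ≤ gValK A pr ent c a w W := fun W => gValK_nonneg hp0 hp1 hA0 ent c a w W
  set G : Finset V → R := fun W => ν W * rValK A pr ent c a W with hGdef
  set G' : Finset V → R := fun W => ν W * gValK A pr ent c a w W with hG'def
  have hG0 : ∀ W, 0 ≤ G W := fun W => mul_nonneg (hν0 W) (hr0 W)
  have hG'0 : ∀ W, 0 ≤ G' W := fun W => mul_nonneg (hν0 W) (hg0 W)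
  have hle : ∀ W, G' W ≤ G W := fun W =>
    mul_le_mul_of_nonneg_left (gValK_le_rValK hp0 hp1 hmono ent c a w W) (hν0 W)
  have wLL : ∀ s ⊆ U, ∀ t ⊆ U, G s * G t ≤ G (s ∩ t) * G (s ∪ t) := by
    intro s hs t ht
    simp only [hGdef]
    calc ν s * rValK A pr ent c a s * (ν t * rValK A pr ent c a t)
        = (ν s * ν t) * (rValK A pr ent c a s * rValK A pr ent c a t) := by ring
      _ ≤ (ν (s ∩ t) * ν (s ∪ t)) *
            (rValK A pr ent c a (s ∩ t) * rValK A pr ent c a (s ∪ t)) :=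
          mul_le_mul (hν s hs t ht) (rValK_mul_le_all A pr ent c a hp0 hp1 hA0 hA hmono s t)
            (mul_nonneg (hr0 _) (hr0 _)) (mul_nonneg (hν0 _) (hν0 _))
      _ = _ := by ring
  have wMM : ∀ s ⊆ U, ∀ t ⊆ U, G' s * G' t ≤ G' (s ∩ t) * G' (s ∪ t) := by
    intro s hs t ht
    simp only [hG'def]
    calc ν s * gValK A pr ent c a w s * (ν t * gValK A pr ent c a w t)
        = (ν s * ν t) * (gValK A pr ent c a w s * gValK A pr ent c a w t) := by ring
      _ ≤ (ν (s ∩ t) * ν (s ∪ t)) *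
            (gValK A pr ent c a w (s ∩ t) * gValK A pr ent c a w (s ∪ t)) :=
          mul_le_mul (hν s hs t ht) (gValK_mul_le_all A pr ent c a w hp0 hp1 hA0 hA hmono s t)
            (mul_nonneg (hg0 _) (hg0 _)) (mul_nonneg (hν0 _) (hν0 _))
      _ = _ := by ring
  have wLM : ∀ s ⊆ U, ∀ t ⊆ U, (∃ r ∈ ent, r ∈ t) →
      G s * G' t ≤ G (s ∩ t) * G' (s ∪ t) := by
    intro s hs t ht hte
    simp only [hGdef, hG'def]
    calc ν s * rValK A pr ent c a s * (ν t * gValK A pr ent c a w t)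
        = (ν s * ν t) * (rValK A pr ent c a s * gValK A pr ent c a w t) := by ring
      _ ≤ (ν (s ∩ t) * ν (s ∪ t)) *
            (rValK A pr ent c a (s ∩ t) * gValK A pr ent c a w (s ∪ t)) :=
          mul_le_mul (hν s hs t ht)
            (rValK_mul_gValK_le_of_entry A pr c a w hsure hA0 hA hmono hte)
            (mul_nonneg (hr0 _) (hg0 _)) (mul_nonneg (hν0 _) (hν0 _))
      _ = _ := by ring
  have wML : ∀ s ⊆ U, ∀ t ⊆ U, (∃ r ∈ ent, r ∈ s) →
      G' s * G t ≤ G (s ∩ t) * G' (s ∪ t) := by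
    intro s hs t ht hse
    have := wLM t ht s hs hse
    rw [Finset.inter_comm, Finset.union_comm, mul_comm] at this
    exact this
  have ent_tf : ∀ W, cellWt (R := R) r₁ r₂ true false W ≠ 0 → ∃ r ∈ ent, r ∈ W :=
    fun W h => ⟨r₁, hr₁, (of_cell_tf h).1⟩
  have ent_ft : ∀ W, cellWt (R := R) r₁ r₂ false true W ≠ 0 → ∃ r ∈ ent, r ∈ W :=
    fun W h => ⟨r₂, hr₂, (of_cell_ft h).2⟩
  have ent_tt : ∀ W, cellWt (R := R) r₁ r₂ true true W ≠ 0 → ∃ r ∈ ent, r ∈ W :=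
    fun W h => ⟨r₁, hr₁, (of_cell_tt h).1⟩
  have no_ff : ∀ W, cellWt (R := R) r₁ r₂ false false W ≠ 0 → ∀ r ∈ ent, r ∉ W := by
    intro W h r hr
    obtain ⟨h1, h2⟩ := of_cell_ff h
    rcases hent r hr with rfl | rfl
    · exact h1
    · exact h2
  -- the state-`0` gate cells are the `R`-law cells
  have st0 : ∀ J : Finset V → R,
      (∑ W ∈ U.powerset, G' W * (cellWt r₁ r₂ false false W * J W)) =
        ∑ W ∈ U.powerset, G W * (cellWt r₁ r₂ false false W * J W) := by
    intro J
    refine Finset.sum_congr rfl fun W _ => ?_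
    by_cases h : cellWt (R := R) r₁ r₂ false false W = 0
    · rw [h]; ring
    · simp only [hGdef, hG'def]
      rw [gValK_eq_rValK_of_no_entry A pr c a w (no_ff W h)]
  -- the raw marker sums as weight sums
  have rawG : ∀ J : Finset V → R,
      (∑ W ∈ U.powerset, ν W * rValK A pr ent c a W * J W) = ∑ W ∈ U.powerset, G W * J W :=
    fun J => Finset.sum_congr rfl fun W _ => by simp only [hGdef]
  have rawG' : ∀ J : Finset V → R,
      (∑ W ∈ U.powerset, ν W * gValK A pr ent c a w W * J W) = ∑ W ∈ U.powerset, G' W * J W :=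
    fun J => Finset.sum_congr rfl fun W _ => by simp only [hG'def]
  have e1 : (∑ W ∈ U.powerset, ν W * rValK A pr ent c a W * (if m₁ ∈ W then (1 : R) else 0)) =
      ∑ W ∈ U.powerset, G W * mWt m₁ true W := by
    rw [← rawG]; exact Finset.sum_congr rfl fun W _ => by rw [mWt_true_apply]
  have e2 : (∑ W ∈ U.powerset, ν W * rValK A pr ent c a W * (if m₂ ∈ W then (1 : R) else 0)) =
      ∑ W ∈ U.powerset, G W * mWt m₂ true W := by
    rw [← rawG]; exact Finset.sum_congr rfl fun W _ => by rw [mWt_true_apply]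
  have e1' : (∑ W ∈ U.powerset, ν W * gValK A pr ent c a w W * (if m₁ ∈ W then (1 : R) else 0)) =
      ∑ W ∈ U.powerset, G' W * mWt m₁ true W := by
    rw [← rawG']; exact Finset.sum_congr rfl fun W _ => by rw [mWt_true_apply]
  have e2' : (∑ W ∈ U.powerset, ν W * gValK A pr ent c a w W * (if m₂ ∈ W then (1 : R) else 0)) =
      ∑ W ∈ U.powerset, G' W * mWt m₂ true W := by
    rw [← rawG']; exact Finset.sum_congr rfl fun W _ => by rw [mWt_true_apply]
  have e12' : (∑ W ∈ U.powerset, ν W * gValK A pr ent c a w W *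
      ((if m₁ ∈ W then (1 : R) else 0) * (if m₂ ∈ W then (1 : R) else 0))) =
      ∑ W ∈ U.powerset, G' W * (mWt m₁ true W * mWt m₂ true W) := by
    rw [← rawG']; exact Finset.sum_congr rfl fun W _ => by rw [mWt_true_apply, mWt_true_apply]
  rw [e1, e2, e1', e2', e12']
  -- the mean orderings of the `R`-law, then the state splits of everything
  have F11 := cellFil U G r₁ m₁ hG0 wLL
  have F12 := cellFil U G r₁ m₂ hG0 wLL
  have F21 := cellFil U G r₂ m₁ hG0 wLL
  have F22 := cellFil U G r₂ m₂ hG0 wLL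
  have Tp1 := cellTop U G r₁ r₂ m₁ hG0 wLL
  have Tp2 := cellTop U G r₁ r₂ m₂ hG0 wLL
  have Id1 := cellId U G r₁ r₂ m₁ hG0 wLL
  have Id2 := cellId U G r₁ r₂ m₂ hG0 wLL
  have sp1 := marker_state_split U G r₁ r₂ (fun _ => 1)
  have spm1 := marker_state_split U G r₁ r₂ (fun W => mWt m₁ true W)
  have spm2 := marker_state_split U G r₁ r₂ (fun W => mWt m₂ true W)
  rw [sum_filter_r₁_one U G r₁ r₂, sum_filter_r₁ U G r₁ r₂ (fun W => mWt m₁ true W), sum_mul_one U G,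
    sp1, spm1] at F11
  rw [sum_filter_r₁_one U G r₁ r₂, sum_filter_r₁ U G r₁ r₂ (fun W => mWt m₂ true W), sum_mul_one U G,
    sp1, spm2] at F12
  rw [sum_filter_r₂_one U G r₁ r₂, sum_filter_r₂ U G r₁ r₂ (fun W => mWt m₁ true W), sum_mul_one U G,
    sp1, spm1] at F21
  rw [sum_filter_r₂_one U G r₁ r₂, sum_filter_r₂ U G r₁ r₂ (fun W => mWt m₂ true W), sum_mul_one U G,
    sp1, spm2] at F22
  rw [sum_mul_one U G, sp1, spm1] at Tp1
  rw [sum_mul_one U G, sp1, spm2] at Tp2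
  rw [sum_mul_one U G, sp1, spm1] at Id1
  rw [sum_mul_one U G, sp1, spm2] at Id2
  rw [sum_mul_one U G, sum_mul_one U G', sp1, spm1, spm2,
    marker_state_split U G' r₁ r₂ (fun _ => 1),
    marker_state_split U G' r₁ r₂ (fun W => mWt m₁ true W),
    marker_state_split U G' r₁ r₂ (fun W => mWt m₂ true W),
    marker_state_split U G' r₁ r₂ (fun W => mWt m₁ true W * mWt m₂ true W),
    st0, st0, st0, st0]
  -- the block theorem
  have hI : ∀ e₁ e₂ W, 0 ≤ cellWt (R := R) r₁ r₂ e₁ e₂ W := fun e₁ e₂ W => cellWt_nonneg _ _ _ _ _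
  have hm12 : ∀ W, 0 ≤ mWt (R := R) m₁ true W * mWt m₂ true W :=
    fun W => mul_nonneg (mWt_nonneg _ _ _) (mWt_nonneg _ _ _)
  have h1 : ∀ W : Finset V, (0 : R) ≤ 1 := fun _ => zero_le_one
  have key := k2State_nonneg
    (∑ W ∈ U.powerset, G W * (cellWt r₁ r₂ false false W * 1))
    (∑ W ∈ U.powerset, G W * (cellWt r₁ r₂ true false W * 1))
    (∑ W ∈ U.powerset, G W * (cellWt r₁ r₂ false true W * 1))
    (∑ W ∈ U.powerset, G W * (cellWt r₁ r₂ true true W * 1))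
    (∑ W ∈ U.powerset, G W * (cellWt r₁ r₂ false false W * mWt m₁ true W))
    (∑ W ∈ U.powerset, G W * (cellWt r₁ r₂ true false W * mWt m₁ true W))
    (∑ W ∈ U.powerset, G W * (cellWt r₁ r₂ false true W * mWt m₁ true W))
    (∑ W ∈ U.powerset, G W * (cellWt r₁ r₂ true true W * mWt m₁ true W))
    (∑ W ∈ U.powerset, G W * (cellWt r₁ r₂ false false W * mWt m₂ true W))
    (∑ W ∈ U.powerset, G W * (cellWt r₁ r₂ true false W * mWt m₂ true W))
    (∑ W ∈ U.powerset, G W * (cellWt r₁ r₂ false true W * mWt m₂ true W))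
    (∑ W ∈ U.powerset, G W * (cellWt r₁ r₂ true true W * mWt m₂ true W))
    (∑ W ∈ U.powerset, G W * (cellWt r₁ r₂ false false W * (mWt m₁ true W * mWt m₂ true W)))
    (∑ W ∈ U.powerset, G W * (cellWt r₁ r₂ true false W * (mWt m₁ true W * mWt m₂ true W)))
    (∑ W ∈ U.powerset, G W * (cellWt r₁ r₂ false true W * (mWt m₁ true W * mWt m₂ true W)))
    (∑ W ∈ U.powerset, G W * (cellWt r₁ r₂ true true W * (mWt m₁ true W * mWt m₂ true W)))
    (∑ W ∈ U.powerset, G' W * (cellWt r₁ r₂ true false W * 1))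
    (∑ W ∈ U.powerset, G' W * (cellWt r₁ r₂ false true W * 1))
    (∑ W ∈ U.powerset, G' W * (cellWt r₁ r₂ true true W * 1))
    (∑ W ∈ U.powerset, G' W * (cellWt r₁ r₂ true false W * mWt m₁ true W))
    (∑ W ∈ U.powerset, G' W * (cellWt r₁ r₂ false true W * mWt m₁ true W))
    (∑ W ∈ U.powerset, G' W * (cellWt r₁ r₂ true true W * mWt m₁ true W))
    (∑ W ∈ U.powerset, G' W * (cellWt r₁ r₂ true false W * mWt m₂ true W))
    (∑ W ∈ U.powerset, G' W * (cellWt r₁ r₂ false true W * mWt m₂ true W))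
    (∑ W ∈ U.powerset, G' W * (cellWt r₁ r₂ true true W * mWt m₂ true W))
    (∑ W ∈ U.powerset, G' W * (cellWt r₁ r₂ true false W * (mWt m₁ true W * mWt m₂ true W)))
    (∑ W ∈ U.powerset, G' W * (cellWt r₁ r₂ false true W * (mWt m₁ true W * mWt m₂ true W)))
    (∑ W ∈ U.powerset, G' W * (cellWt r₁ r₂ true true W * (mWt m₁ true W * mWt m₂ true W)))
    (cell_nonneg' U G _ _ hG0 (hI _ _) hm12) (cell_nonneg' U G _ _ hG0 (hI _ _) hm12)
    (cell_nonneg' U G _ _ hG0 (hI _ _) hm12) (cell_nonneg' U G _ _ hG0 (hI _ _) hm12)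
    (cellBlk U G _ m₁ m₂ hG0 (hI false false)).1 (cellBlk U G _ m₁ m₂ hG0 (hI true false)).1
    (cellBlk U G _ m₁ m₂ hG0 (hI false true)).1 (cellBlk U G _ m₁ m₂ hG0 (hI true true)).1
    (cellBlk U G _ m₁ m₂ hG0 (hI false false)).2.1 (cellBlk U G _ m₁ m₂ hG0 (hI true false)).2.1
    (cellBlk U G _ m₁ m₂ hG0 (hI false true)).2.1 (cellBlk U G _ m₁ m₂ hG0 (hI true true)).2.1
    (cellBlk U G _ m₁ m₂ hG0 (hI false false)).2.2 (cellBlk U G _ m₁ m₂ hG0 (hI true false)).2.2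
    (cellBlk U G _ m₁ m₂ hG0 (hI false true)).2.2 (cellBlk U G _ m₁ m₂ hG0 (hI true true)).2.2
    (cell_nonneg' U G' _ _ hG'0 (hI _ _) hm12) (cell_nonneg' U G' _ _ hG'0 (hI _ _) hm12)
    (cell_nonneg' U G' _ _ hG'0 (hI _ _) hm12)
    (cellBlk U G' _ m₁ m₂ hG'0 (hI true false)).1 (cellBlk U G' _ m₁ m₂ hG'0 (hI false true)).1
    (cellBlk U G' _ m₁ m₂ hG'0 (hI true true)).1
    (cellBlk U G' _ m₁ m₂ hG'0 (hI true false)).2.1 (cellBlk U G' _ m₁ m₂ hG'0 (hI false true)).2.1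
    (cellBlk U G' _ m₁ m₂ hG'0 (hI true true)).2.1
    (cellBlk U G' _ m₁ m₂ hG'0 (hI true false)).2.2 (cellBlk U G' _ m₁ m₂ hG'0 (hI false true)).2.2
    (cellBlk U G' _ m₁ m₂ hG'0 (hI true true)).2.2
    (cellC U G r₁ r₂ m₁ m₂ false false hG0 wLL) (cellC U G' r₁ r₂ m₁ m₂ true false hG'0 wMM)
    (cellC U G' r₁ r₂ m₁ m₂ false true hG'0 wMM) (cellC U G' r₁ r₂ m₁ m₂ true true hG'0 wMM)
    (cellT U G G' r₁ r₂ m₁ true false hG0 hG'0 (fun s hs t ht h => wLM s hs t ht (ent_tf t h)))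
    (cellT U G G' r₁ r₂ m₁ false true hG0 hG'0 (fun s hs t ht h => wLM s hs t ht (ent_ft t h)))
    (cellT U G G' r₁ r₂ m₁ true true hG0 hG'0 (fun s hs t ht h => wLM s hs t ht (ent_tt t h)))
    (cellT U G G' r₁ r₂ m₂ true false hG0 hG'0 (fun s hs t ht h => wLM s hs t ht (ent_tf t h)))
    (cellT U G G' r₁ r₂ m₂ false true hG0 hG'0 (fun s hs t ht h => wLM s hs t ht (ent_ft t h)))
    (cellT U G G' r₁ r₂ m₂ true true hG0 hG'0 (fun s hs t ht h => wLM s hs t ht (ent_tt t h)))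
    (cellGm U G G' r₁ r₂ m₁ false false true false hG0 hG'0
      (fun s hs t ht h => wLM s hs t ht (ent_tf t h)))
    (cellGm U G G' r₁ r₂ m₁ false false false true hG0 hG'0
      (fun s hs t ht h => wLM s hs t ht (ent_ft t h)))
    (cellGm U G' G' r₁ r₂ m₁ true false true true hG'0 hG'0 (fun s hs t ht _ => wMM s hs t ht))
    (cellGm U G' G' r₁ r₂ m₁ false true true true hG'0 hG'0 (fun s hs t ht _ => wMM s hs t ht))
    (cellGm U G G' r₁ r₂ m₂ false false true false hG0 hG'0
      (fun s hs t ht h => wLM s hs t ht (ent_tf t h)))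
    (cellGm U G G' r₁ r₂ m₂ false false false true hG0 hG'0
      (fun s hs t ht h => wLM s hs t ht (ent_ft t h)))
    (cellGm U G' G' r₁ r₂ m₂ true false true true hG'0 hG'0 (fun s hs t ht _ => wMM s hs t ht))
    (cellGm U G' G' r₁ r₂ m₂ false true true true hG'0 hG'0 (fun s hs t ht _ => wMM s hs t ht))
    (by linarith [F11]) (by linarith [F21]) (by linarith [F12]) (by linarith [F22])
    (by linarith [Tp1]) (by linarith [Tp2]) (by linarith [Id1]) (by linarith [Id2])
    (cellLsm U G r₁ r₂ hG0 wLL)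
    (cellLe U G G' _ _ hle (hI true false) h1) (cellLe U G G' _ _ hle (hI false true) h1)
    (cellLe U G G' _ _ hle (hI true true) h1)
    (cellR U G G' r₁ r₂ true false hG0 hG'0 (fun s hs t ht h => wML s hs t ht (ent_tf s h)))
    (cellR U G G' r₁ r₂ false true hG0 hG'0 (fun s hs t ht h => wML s hs t ht (ent_ft s h)))
  linarith [key]

end K2AwareFunctional

section K2AwareMain

variable {V : Type*} {E : Type*} [Fintype V] [DecidableEq V] [Fintype E] [DecidableEq E]
  {R : Type*} [Field R] [LinearOrder R] [IsStrictOrderedRing R]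
  {arcs : E → Finset (V × V)} {s : V} {U : Finset V} {ent : Finset V} {c : V → E} {a w : V}

/-- **THEOREM (row 2′DARC at an OR-tail with two incomparable uncovered entries — ANY head).**
`OrTailK arcs s U ent c a` with `ent = {r₁, r₂}` (`hr₁, hr₂, hent`) and SURE tail coins
(`hsure`), `SameEnds`, the cluster law of `U` log-supermodular (`hν`), ANY two markers
`m₁, m₂ ∈ U`, `t, w ∉ U ∪ {a, s}` ⟹ `Φ_D({s ↛ t in D + (a → w)}) ≥ 0` for the markers `m₁, m₂`
at every head (the head sees the whole cluster), every probability vector — no head-blindness,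
no non-degeneracy. -/
theorem darc_of_orTailK2 (pr : E → R) (hp : IsProbVec pr) (hS : SameEnds arcs)
    (h : OrTailK arcs s U ent c a) {r₁ r₂ m₁ m₂ : V} (hm₁ : m₁ ∈ U) (hm₂ : m₂ ∈ U)
    (hr₁ : r₁ ∈ ent) (hr₂ : r₂ ∈ ent) (hent : ∀ r ∈ ent, r = r₁ ∨ r = r₂)
    (hsure : ∀ r ∈ ent, pr (c r) = 1)
    (hν : ∀ W W', W ⊆ U → W' ⊆ U →
      prob pr (coreLevel arcs s U W) * prob pr (coreLevel arcs s U W') ≤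
        prob pr (coreLevel arcs s U (W ∩ W')) * prob pr (coreLevel arcs s U (W ∪ W')))
    {t : V} (htC : t ∉ insert a U) (hts : t ≠ s) (hws : w ≠ s) (hwC : w ∉ insert a U) :
    DARC pr arcs s {t} m₁ m₂ a w := by
  have hC := h.closedInCoreU
  have hm₁a : m₁ ≠ a := fun e => h.a_notin (e ▸ hm₁)
  have hm₂a : m₂ ≠ a := fun e => h.a_notin (e ▸ hm₂)
  have hm₁C : m₁ ∈ insert a U := Finset.mem_insert_of_mem hm₁
  have hm₂C : m₂ ∈ insert a U := Finset.mem_insert_of_mem hm₂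
  have haC : a ∈ insert a U := Finset.mem_insert_self _ _
  unfold DARC
  rw [hC.phiC_gate_eq pr hS htC hts hm₁C hm₂C haC hws hwC]
  have hm1 : ∀ W : Finset V, (fun _ : Finset V => (1 : R)) (insert a W) = (fun _ => (1 : R)) W :=
    fun _ => rfl
  have hmp : ∀ W : Finset V, (fun W : Finset V => if m₁ ∈ W then (1 : R) else 0) (insert a W) =
      (fun W : Finset V => if m₁ ∈ W then (1 : R) else 0) W := by
    intro W; simp only [Finset.mem_insert, hm₁a, false_or]
  have hmq : ∀ W : Finset V, (fun W : Finset V => if m₂ ∈ W then (1 : R) else 0) (insert a W) =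
      (fun W : Finset V => if m₂ ∈ W then (1 : R) else 0) W := by
    intro W; simp only [Finset.mem_insert, hm₂a, false_or]
  have hmpq : ∀ W : Finset V,
      (fun W : Finset V => (if m₁ ∈ W then (1 : R) else 0) * (if m₂ ∈ W then (1 : R) else 0))
        (insert a W) =
      (fun W : Finset V => (if m₁ ∈ W then (1 : R) else 0) * (if m₂ ∈ W then (1 : R) else 0)) W := by
    intro W; simp only [Finset.mem_insert, hm₁a, hm₂a, false_or]
  have eΛ := h.sum_R_eq pr t (fun _ => (1 : R)) hm1
  have eFa := h.sum_R_eq pr t (fun W => if m₁ ∈ W then (1 : R) else 0) hmp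
  have eFb := h.sum_R_eq pr t (fun W => if m₂ ∈ W then (1 : R) else 0) hmq
  have eM := h.sum_G_eq (w := w) pr t (fun _ => (1 : R)) hm1
  have eX := h.sum_G_eq (w := w) pr t (fun W => if m₁ ∈ W then (1 : R) else 0) hmp
  have eY := h.sum_G_eq (w := w) pr t (fun W => if m₂ ∈ W then (1 : R) else 0) hmq
  have eXY := h.sum_G_eq (w := w) pr t
    (fun W => (if m₁ ∈ W then (1 : R) else 0) * (if m₂ ∈ W then (1 : R) else 0)) hmpq
  simp only [mul_one] at eΛ eM
  rw [eΛ, eFa, eFb, eM, eX, eY, eXY]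
  obtain ⟨hA0, hAmono, hAlsm⟩ := OrTailU.head_props (U := U) (a := a) pr hp hS t
  exact orTailK2_functional_nonneg U (fun W => prob pr (coreLevel arcs s U W))
    (fun X => prob pr (coreAvoidEvent arcs s t (insert a U) X)) pr ent c r₁ r₂ m₁ m₂ a w
    hp.nonneg hp.le_one hsure hr₁ hr₂ hent (fun W => prob_nonneg hp _)
    (fun s' hs' t' ht' => hν s' t' hs' ht') hA0 hAlsm hAmono

end K2AwareMain

end Summit.Ventures.PercRepro2.Coin
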